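import Summits.BirchSwinnertonDyer.Rank1Residual.X11b.PoitouTateSelmerCounting
import Summits.BirchSwinnertonDyer.Rank1Residual.X11b.KummerStructureDuality
import Summits.BirchSwinnertonDyer.Rank1Residual.X11b.KummerRelaxedStructures
import Summits.BirchSwinnertonDyer.Rank1Residual.GaloisImage.PropagatedConditionCoisotropic
import Literature.NumberTheory.EllipticCurves.ArchimedeanWeilPairingDuality
import HarnessLib

/-!
# The SELF-DUAL relaxed/strict count at one finite place:
# `[H¹_{𝓛^{v₀}}(K, E[n]) : H¹_{𝓛_{v₀}}(K, E[n])]² = #H¹(K_{v₀}, E[n])`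
# (cell `b2b-bsdres`; O1 PROVER ORDER v2.8 item (ii) "G3-T4: exact Poitou–Tate at `2`, target form
# `a − b = 1 + e`" (cells/o1/PLAN.md C69/C80; REFUTER-O1 §19 D5), written for EVERY number field `K`,
# every elliptic curve `E/K`, every prime power `n` and every finite place `v₀`; seat x11b3-p9 GEN 2,
# cross-cell pool work)

HONEST FRAMING (cell `b2b-bsdres`, run/shared/lean/b2b/bsd-rank1-residual/, verbatim in every file): the
goal of the cell is to DELETE the COMBINATION-SHAPED residual classes of the Birch–Swinnerton-Dyer
formula for ALL analytic-rank `≤ 1` elliptic curves over `ℚ` — "full BSD formula for every rank `≤ 1`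
curve in class `C`" assembled STRICTLY from published theorems — so that the rank-`≤ 1` remainder
becomes exactly the CONSTRUCTION-SHAPED classes, which are TYPED (missing-input `Prop`s), NOT
attempted. This is not "finishing BSD". Team O1 (X5 at `p = 2`): research routes; O1 OPEN; nothing
booked; no mark / label / count moved. THEOREMS ONLY: no definition, no named fact is minted, no
`sorry`. CONDITIONAL, exactly as its inputs `X11b/PoitouTateSelmerCounting.lean` (multr1-p1) and
`GaloisImage/PropagatedConditionCoisotropic.lean` (n1011-p18), on a family `inv` of local invariant maps
with the properties recorded by the tree's named fact `poitouTate_selmerStructure_duality` (Howard 2004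
Thm. 2.1.11, Milne ADT I Cor. 2.3 / Thm. 4.10) and on Tate's local Euler–Poincaré characteristic
formula (named fact `localEulerPoincareCharacteristic`, Milne ADT I Thm. 2.8) — both taken as
HYPOTHESES — and, at the REAL places of `K`, on the injectivity of `inv_w` on `H²(K_w, μₙ) = Br(K_w)[n]`
(true for the invariant maps of class field theory, `Br(ℝ) = ½ℤ/ℤ`; NOT recorded by the tree's fact —
the same extra binder as `Literature/…/CasselsTateLemma615LocalInputs.lean`; vacuous when `K` is
totally complex).

## What this file proves

Let `𝓛` be a Selmer structure on `E[n]` (`W.torsionGaloisModule n`), `v₀` a FINITE place, and write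
`𝓛^{v₀} = Function.update 𝓛 v₀ ⊤` (RELAXED at `v₀`) and `𝓛_{v₀} = Function.update 𝓛 v₀ ⊥` (STRICT at
`v₀`).  Suppose `𝓛` is **residually self-dual away from `v₀`** for the Weil transport
`w : E[n] ⥲ E[n]^D = Hom(E[n], μₙ)` — `inv.dualTransported 𝓛 w v = 𝓛 v` for `v ≠ v₀`, i.e. each `𝓛_v`
is its own annihilator under `inv_v(· ∪ₑ ·)` (Sakamoto 2024 §3.1.2 / Def. 3.9: no place `≠ v₀` is
exceptional; `Literature/…/GaloisCohomology/KolyvaginSystems.lean`).  Then: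

* §1 `map_weilDual_mem_dualSelmerGroup_iff`, `dualSelmerGroup_eq_map_selmerGroup_dualTransported` — the
  dual Selmer group `H¹_{𝓐^*}(K, E[n]^D)` of ANY structure `𝓐` is the Weil transport
  `H¹(w)(H¹_{w⁻¹𝓐^*}(K, E[n]))` of the Selmer group of Sakamoto's transported dual structure
  (naturality of localisation + `⟨a, H¹(w_v) b⟩_v = inv_v(a ∪ₑ b)`,
  `X11b.LocBridge.localTatePairingZMod_map_weilDual`);
* §2 `dualTransported_update_bot`, `dualTransported_update_top` — `w⁻¹((𝓛_{v₀})^*) = (w⁻¹𝓛^*)^{v₀}` and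
  `w⁻¹((𝓛^{v₀})^*) = (w⁻¹𝓛^*)_{v₀}` (`(0)^* = everything`; `(everything)^* = 0` by local Tate duality
  at the finite `v₀` and the injectivity of `H¹(w_{v₀})`);
* §3 **`relIndex_update_bot_update_top_sq_eq_natCard`** — the MAIN THEOREM
  `[H¹_{𝓛^{v₀}} : H¹_{𝓛_{v₀}}]² = #H¹(K_{v₀}, E[n])`: multr1-p1's one-place counting form of
  Poitou–Tate duality `[H¹_𝓖 : H¹_𝓕] · [H¹_{𝓕^*} : H¹_{𝓖^*}] = [𝓖_{v₀} : 𝓕_{v₀}]`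
  (`X11b.PoitouTateCounting.relIndex_selmerGroup_mul_relIndex_dual_eq`, Howard Thm. 2.1.11 / JSW17
  Prop. 3.2.1) for `𝓕 = 𝓛_{v₀} ≤ 𝓖 = 𝓛^{v₀}`, where by §1–§2 and self-duality
  `H¹_{𝓕^*} = H¹(w)(H¹_𝓖)` and `H¹_{𝓖^*} = H¹(w)(H¹_𝓕)`, so the second factor EQUALS the first
  (Mathlib `AddSubgroup.relIndex_map_map_of_injective`); this is the finite-level shape of
  Mazur–Rubin's / DDT Thm. 2.19's "`dim H¹_{𝓕^v} − dim H¹_{𝓕_v} = ½ · dim H¹(K_v, T)` for self-dual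
  `T`";
* §4 `relIndex_update_bot_update_top_eq_of_localEuler` — with Tate's local Euler characteristic at
  `v₀` (`#H¹(K_{v₀}, E[n]) = (#E(K_{v₀})[n] · #(𝓞_{v₀}/n))²`, tree
  `natCard_galoisCohomology_one_torsion_adicCompletion_eq_sq`):
  **`[H¹_{𝓛^{v₀}} : H¹_{𝓛_{v₀}}] = #E(K_{v₀})[n] · #(𝓞_{v₀}/n)`**;
* SEQUEL `X5/KummerRelaxedStrictCount.lean`: the KUMMER structure `𝓚 = kummerSelmerStructure` (Selmer
  group `Sel^{(n)}(E/K)`) is residually self-dual at every place — finite places by n1011-p18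
  (`dualTransported_kummerSelmerStructure_inr`), complex places trivially, REAL places given `inv_w`
  injective (archimedean Tate duality, Milne I Thm. 2.13 / Rem. 3.7) — hence for `n = p^k`
  `[Sel^{(n)} relaxed at v₀ : Sel^{(n)} strict at v₀] = #E(K_{v₀})[n] · #(𝓞_{v₀}/n)`.

At `K = ℚ`, `n = 2`, `v₀ = 2` this reads `a − b = 1 + e` with `e = dim_{𝔽₂} E(ℚ₂)[2]` (REFUTER-O1 §19
D5: relaxed/strict at `2`, Kummer elsewhere; the solitaire's TRANSVERSE conditions at Kolyvagin primes
enter §3 through the abstract self-duality hypothesis `hsd` — their discharge is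
`Literature/…/GaloisCohomology/PoitouTateTransverseDuality.lean`, not done here).  No `RΓ_c` /
archimedean Euler-characteristic factor is needed: in the RELATIVE count the places `≠ v₀` cancel, the
real places included (this is why the infinite place costs only the injectivity of `inv_w`).

References: [Howard2004HeegnerKolyvagin] Def. 2.1.6, 2.1.10, Thm. 2.1.11; [MilneADT2006] I Cor. 2.3,
Thm. 2.8, Thm. 2.13, Rem. 3.7, Cor. 3.4, Thm. 4.10, Lemma 6.15; [MazurRubin2004] §2.3, Thm. 2.3.4;
[DDT] Thm. 2.19; [Sakamoto2024] §3.1.2, Def. 3.8–3.9; [JetchevSkinnerWan2017] Prop. 3.2.1;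
[PoonenRains2012] Prop. 4.10; [SilvermanAEC2009] III.8.1.
-/

noncomputable section

open scoped Classical

universe u

open CategoryTheory Field Function NumberField IsDedekindDomain WeierstrassCurve
open Literature.NumberTheory.EllipticCurves
open Literature.NumberTheory.GaloisRepresentations
open Literature.NumberTheory.GaloisRepresentations.DiscreteGaloisModule (mu MuCarrier SelmerStructure
  localTatePairingZMod tateDual localMap)
open Literature.NumberTheory.GaloisCohomology
open Summit.BirchSwinnertonDyer.Rank1Residual.X11b.LocBridge
open Summit.BirchSwinnertonDyer.Rank1Residual.X11b.Levels
open scoped ContRepresentation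

namespace Summit.BirchSwinnertonDyer.Rank1Residual.X5.SelfDualCount

-- Cup products need `LocallyCompactSpace Γ`; as in the tree's cup-product files, the compactness of
-- absolute Galois groups is a local instance only; so are the finiteness of `E[n]` and of `μₙ`.
attribute [local instance] absoluteGaloisGroup_compactSpace
attribute [local instance] finite_geomTorsion_of_neZero Literature.NumberTheory.EllipticCurves.finite_muCarrier

section General

variable {K : Type u} [Field K] [NumberField K] (W : WeierstrassCurve K) (n : ℕ) [NeZero n]
  [W.IsElliptic]
variable (e : geomTorsion W n → geomTorsion W n → AlgebraicClosure K)
  (hμ : ∀ S T, e S T ^ n = 1)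
  (hadd₁ : ∀ S₁ S₂ T, e (S₁ + S₂) T = e S₁ T * e S₂ T)
  (hadd₂ : ∀ S T₁ T₂, e S (T₁ + T₂) = e S T₁ * e S T₂)
  (hgal : ∀ (σ : absoluteGaloisGroup K) (S T : geomTorsion W n), σ • e S T = e (σ • S) (σ • T))
  (hnondeg : ∀ T, (∀ S, e S T = 1) → T = 0)
  (inv : LocalInvariants K n)

/-! ## §1. The dual Selmer group is the Weil transport of the Selmer group of `w⁻¹𝓐^*` -/

/-- **`H¹(w) x ∈ H¹_{𝓐^*}(K, E[n]^D) ↔ x ∈ H¹_{w⁻¹𝓐^*}(K, E[n])`** for every Selmer structure `𝓐` on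
`E[n]` and every global class `x`: naturality of localisation (`loc_v ∘ H¹(w) = H¹(w_v) ∘ loc_v`) and
the definition of Sakamoto's transported dual structure `(w⁻¹𝓐^*)_v = H¹(w_v)⁻¹(𝓐_v^*)`.
[cite: Sakamoto2024, §3.1.2 (p. 924)] [cite: Howard2004HeegnerKolyvagin, Def. 2.1.10 (arXiv:1202.6340 p. 6)] -/
theorem map_weilDual_mem_dualSelmerGroup_iff (𝓐 : SelmerStructure (W.torsionGaloisModule n))
    (x : galoisCohomology (W.torsionGaloisModule n) 1) :
    galoisCohomology.map (weilDualIntertwining W n e hμ hadd₁ hadd₂ hgal) 1 x ∈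
        (inv.dualSelmerStructure (W.torsionGaloisModule n) 𝓐).selmerGroup ↔
      x ∈ (inv.dualTransported 𝓐 (weilDualIntertwining W n e hμ hadd₁ hadd₂ hgal)).selmerGroup := by
  simp only [SelmerStructure.mem_selmerGroup_iff, LocalInvariants.mem_dualTransported_iff]
  refine forall_congr' fun v => ?_
  rw [localization_map_one]
  rfl

include hnondeg in
/-- **`H¹_{𝓐^*}(K, E[n]^D) = H¹(w)(H¹_{w⁻¹𝓐^*}(K, E[n]))`**: the dual Selmer group of ANY Selmer
structure `𝓐` on `E[n]` is the Weil transport of the Selmer group of the transported dual structure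
(`map_weilDual_mem_dualSelmerGroup_iff` and the surjectivity of `H¹(w)`, every class of
`H¹(K, E[n]^D)` being `H¹(w)(H¹(w⁻¹) y)`, `X11b.LocBridge.map_weilDual_map_weilDualInv`). The finite-level
form of "`T^* = T`, `𝓕^*` read on `T`" (JSW17 Prop. 3.2.1; Sakamoto §3.1.2).
[cite: Sakamoto2024, §3.1.2 (p. 924)] [cite: JetchevSkinnerWan2017, Prop. 3.2.1 (proof, arXiv:1512.06894 p. 10)] -/
theorem dualSelmerGroup_eq_map_selmerGroup_dualTransported
    (𝓐 : SelmerStructure (W.torsionGaloisModule n)) :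
    (inv.dualSelmerStructure (W.torsionGaloisModule n) 𝓐).selmerGroup =
      (inv.dualTransported 𝓐 (weilDualIntertwining W n e hμ hadd₁ hadd₂ hgal)).selmerGroup.map
        (galoisCohomology.map (weilDualIntertwining W n e hμ hadd₁ hadd₂ hgal) 1) := by
  ext y
  constructor
  · intro hy
    refine ⟨galoisCohomology.map (weilDualInv W n e hμ hadd₁ hadd₂ hgal hnondeg) 1 y, ?_,
      map_weilDual_map_weilDualInv W n e hμ hadd₁ hadd₂ hgal hnondeg y⟩
    rw [SetLike.mem_coe, ← map_weilDual_mem_dualSelmerGroup_iff W n e hμ hadd₁ hadd₂ hgal inv,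
      map_weilDual_map_weilDualInv]
    exact hy
  · rintro ⟨x, hx, rfl⟩
    exact (map_weilDual_mem_dualSelmerGroup_iff W n e hμ hadd₁ hadd₂ hgal inv 𝓐 x).2 hx

include hnondeg in
/-- `H¹(w) : H¹(K, E[n]) → H¹(K, E[n]^D)` is injective (it has the left inverse `H¹(w⁻¹)`,
`X11b.LocBridge.map_weilDualInv_map_weilDual`). [cite: SilvermanAEC2009, Prop. III.8.1] -/
theorem map_weilDual_injective :
    Injective (galoisCohomology.map (weilDualIntertwining W n e hμ hadd₁ hadd₂ hgal) 1) :=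
  Function.LeftInverse.injective (g := galoisCohomology.map (weilDualInv W n e hμ hadd₁ hadd₂ hgal hnondeg) 1)
    (map_weilDualInv_map_weilDual W n e hμ hadd₁ hadd₂ hgal hnondeg)

/-! ## §2. The transported duals of the strict and the relaxed modification at one place -/

/-- **`w⁻¹((𝓛_{v₀})^*) = (w⁻¹𝓛^*)^{v₀}`**: making `𝓛` STRICT at `v₀` makes the transported dual RELAXED
at `v₀` (`(0)^* = H¹(K_{v₀}, E[n]^D)`, tree `LocalInvariants.dualLocalCondition_bot`) and leaves it
unchanged elsewhere. [cite: Howard2004HeegnerKolyvagin, Def. 2.1.1 and Def. 2.1.6 (arXiv:1202.6340 p. 5)] -/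
theorem dualTransported_update_bot (𝓛 : SelmerStructure (W.torsionGaloisModule n)) (v₀ : Place K) :
    inv.dualTransported (Function.update 𝓛 v₀ ⊥) (weilDualIntertwining W n e hμ hadd₁ hadd₂ hgal) =
      Function.update (inv.dualTransported 𝓛 (weilDualIntertwining W n e hμ hadd₁ hadd₂ hgal)) v₀ ⊤ := by
  funext v
  by_cases hv : v = v₀
  · subst hv
    rw [Function.update_self]
    ext y
    simp only [LocalInvariants.mem_dualTransported_iff, LocalInvariants.dualSelmerStructure_apply,
      Function.update_self, LocalInvariants.dualLocalCondition_bot, AddSubgroup.mem_top]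
  · rw [Function.update_of_ne hv]
    ext y
    simp only [LocalInvariants.mem_dualTransported_iff, LocalInvariants.dualSelmerStructure_apply,
      Function.update_of_ne hv]

include hnondeg in
/-- **`w⁻¹((𝓛^{v₀})^*) = (w⁻¹𝓛^*)_{v₀}` at a FINITE place `v₀` where `inv_{v₀}` is a local Tate
duality** (`LocalInvariants.IsPerfect`): making `𝓛` RELAXED at `v₀` makes the transported dual STRICT at
`v₀` — `(H¹(K_{v₀}, E[n]))^* = 0` (tree `X11b.PoitouTateCounting.dualLocalCondition_top`, Milne I
Cor. 2.3) and `H¹(w_{v₀})` is injective (`X11b.LocBridge.map_weilDual_restrictField_injective`).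
[cite: Howard2004HeegnerKolyvagin, Def. 2.1.1 and Def. 2.1.6 (arXiv:1202.6340 p. 5)] [cite: MilneADT2006, Ch. I, Cor. 2.3] -/
theorem dualTransported_update_top (hperf : inv.IsPerfect)
    (𝓛 : SelmerStructure (W.torsionGaloisModule n)) (w₀ : HeightOneSpectrum (𝓞 K)) :
    inv.dualTransported (Function.update 𝓛 (Sum.inr w₀) ⊤) (weilDualIntertwining W n e hμ hadd₁ hadd₂ hgal) =
      Function.update (inv.dualTransported 𝓛 (weilDualIntertwining W n e hμ hadd₁ hadd₂ hgal))
        (Sum.inr w₀) ⊥ := by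
  funext v
  by_cases hv : v = Sum.inr w₀
  · subst hv
    rw [Function.update_self]
    ext y
    simp only [LocalInvariants.mem_dualTransported_iff, LocalInvariants.dualSelmerStructure_apply,
      Function.update_self, AddSubgroup.mem_bot]
    rw [X11b.PoitouTateCounting.dualLocalCondition_top hperf (W.torsionGaloisModule n)
      (fun T : geomTorsion W n => AddSubgroup.torsionBy.nsmul T) w₀, AddSubgroup.mem_bot]
    constructor
    · intro h
      exact map_weilDual_restrictField_injective W n e hμ hadd₁ hadd₂ hgal hnondeg
        (Place.Completion (Sum.inr w₀ : Place K)) (h.trans (map_zero _).symm)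
    · intro h
      rw [h]
      exact map_zero _
  · rw [Function.update_of_ne hv]
    ext y
    simp only [LocalInvariants.mem_dualTransported_iff, LocalInvariants.dualSelmerStructure_apply,
      Function.update_of_ne hv]

/-! ## §3. MAIN THEOREM: `[H¹_{𝓛^{v₀}} : H¹_{𝓛_{v₀}}]² = #H¹(K_{v₀}, E[n])` for residually self-dual `𝓛` -/

omit [NeZero n] [W.IsElliptic] in
/-- `𝓛_{v₀} ≤ 𝓛^{v₀}`. [folklore] -/
theorem update_bot_le_update_top (𝓛 : SelmerStructure (W.torsionGaloisModule n)) (v₀ : Place K) :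
    Function.update 𝓛 v₀ ⊥ ≤ Function.update 𝓛 v₀ ⊤ := by
  intro v
  by_cases hv : v = v₀
  · subst hv; rw [Function.update_self, Function.update_self]; exact bot_le
  · rw [Function.update_of_ne hv, Function.update_of_ne hv]

omit [NeZero n] [W.IsElliptic] in
/-- `𝓛_{v₀}` and `𝓛^{v₀}` agree away from `v₀`. [folklore] -/
theorem update_bot_eq_update_top_of_ne (𝓛 : SelmerStructure (W.torsionGaloisModule n)) (v₀ : Place K)
    (v : Place K) (hv : v ≠ v₀) :
    Function.update 𝓛 v₀ ⊥ v = Function.update 𝓛 v₀ ⊤ v := by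
  rw [Function.update_of_ne hv, Function.update_of_ne hv]

omit [NeZero n] [W.IsElliptic] in
/-- Modifying a Selmer structure unramified outside `S` at a place of `S` keeps it unramified outside
`S` (Howard Def. 2.1.10: `Σ` unchanged). [cite: Howard2004HeegnerKolyvagin, Def. 2.1.10 (arXiv:1202.6340 p. 6)] -/
theorem isUnramifiedOutside_update {𝓛 : SelmerStructure (W.torsionGaloisModule n)} {S : Finset (Place K)}
    (h𝓛 : 𝓛.IsUnramifiedOutside S) {v₀ : Place K} (hv₀ : v₀ ∈ S)
    (L : AddSubgroup (galoisCohomology ((W.torsionGaloisModule n).toLocal v₀) 1)) :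
    SelmerStructure.IsUnramifiedOutside (Function.update 𝓛 v₀ L) S := by
  refine ⟨h𝓛.1, fun v hv => ?_⟩
  have hne : (Sum.inr v : Place K) ≠ v₀ := fun h => hv (h ▸ hv₀)
  rw [Function.update_of_ne hne]
  exact h𝓛.2 v hv

include hnondeg in
/-- **MAIN THEOREM — the self-dual relaxed/strict count at one finite place.**  Let `inv` be a family
of local invariant maps with local Tate duality at the finite places, the Poitou–Tate vanishing and
Howard's complement property (`IsPerfect`, `SumLocalTermEqZero`, `SelmerComplement` — the content of the
tree's named fact `poitouTate_selmerStructure_duality K`), `S ⊇ {v ∣ ∞} ∪ {v ∣ n} ∪ Ram(E[n])` finite,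
`𝓛` a Selmer structure on `E[n]` unramified outside `S`, `v₀ ∈ S` FINITE, and suppose `𝓛` is
RESIDUALLY SELF-DUAL AWAY FROM `v₀` for the Weil transport `w` (`w⁻¹(𝓛_v^*) = 𝓛_v` for `v ≠ v₀`: every
`𝓛_v` is its own annihilator under `inv_v(· ∪ₑ ·)`; Sakamoto Def. 3.9: no place `≠ v₀` is exceptional).
Then

  `[H¹_{𝓛^{v₀}}(K, E[n]) : H¹_{𝓛_{v₀}}(K, E[n])]² = #H¹(K_{v₀}, E[n])`.

Proof: multr1-p1's counting form of Howard Thm. 2.1.11 at one place for `𝓕 = 𝓛_{v₀} ≤ 𝓖 = 𝓛^{v₀}`,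
`[H¹_𝓖 : H¹_𝓕] · [H¹_{𝓕^*} : H¹_{𝓖^*}] = [H¹(K_{v₀}, E[n]) : 0]`, with `H¹_{𝓕^*} = H¹(w)(H¹_𝓖)` and
`H¹_{𝓖^*} = H¹(w)(H¹_𝓕)` (§1–§2 + self-duality), `H¹(w)` injective. The finite-level, relative shape of
DDT Thm. 2.19 / Mazur–Rubin: `dim H¹_{𝓕^q} − dim H¹_{𝓕_q} = ½ dim H¹(K_q, T)` for self-dual `T`.
CONDITIONAL on the properties of `inv` (hypotheses); nothing booked.
[cite: Howard2004HeegnerKolyvagin, Thm. 2.1.11 (arXiv:1202.6340 p. 6)]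
[cite: JetchevSkinnerWan2017, Prop. 3.2.1 (proof, arXiv:1512.06894 p. 10)]
[cite: Sakamoto2024, §3.1.2 and Def. 3.9 (p. 924)] -/
theorem relIndex_update_bot_update_top_sq_eq_natCard (hperf : inv.IsPerfect)
    (hvan : inv.SumLocalTermEqZero) (hcomp : inv.SelmerComplement) {S : Finset (Place K)}
    (hS : ∀ v : HeightOneSpectrum (𝓞 K), (Sum.inr v : Place K) ∉ S →
      ((n : ℕ) : 𝓞 K) ∉ v.asIdeal ∧ GaloisRep.IsUnramifiedAt v (W.torsionGaloisModule n))
    {𝓛 : SelmerStructure (W.torsionGaloisModule n)} (h𝓛 : 𝓛.IsUnramifiedOutside S)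
    {w₀ : HeightOneSpectrum (𝓞 K)} (hw₀ : (Sum.inr w₀ : Place K) ∈ S)
    (hsd : ∀ v ≠ (Sum.inr w₀ : Place K),
      inv.dualTransported 𝓛 (weilDualIntertwining W n e hμ hadd₁ hadd₂ hgal) v = 𝓛 v) :
    ((SelmerStructure.selmerGroup
          (Function.update 𝓛 (Sum.inr w₀) ⊥ : SelmerStructure (W.torsionGaloisModule n))).relIndex
        (SelmerStructure.selmerGroup
          (Function.update 𝓛 (Sum.inr w₀) ⊤ : SelmerStructure (W.torsionGaloisModule n)))) ^ 2 =
      Nat.card (galoisCohomology ((W.torsionGaloisModule n).toLocal (Sum.inr w₀)) 1) := by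
  set v₀ : Place K := Sum.inr w₀ with hv₀def
  set θ := weilDualIntertwining W n e hμ hadd₁ hadd₂ hgal with hθ
  set 𝓕 : SelmerStructure (W.torsionGaloisModule n) := Function.update 𝓛 v₀ ⊥ with h𝓕
  set 𝓖 : SelmerStructure (W.torsionGaloisModule n) := Function.update 𝓛 v₀ ⊤ with h𝓖
  have hM : ∀ T : geomTorsion W n, n • T = 0 := fun T => AddSubgroup.torsionBy.nsmul T
  -- the transported dual structure of `𝓛` agrees with `𝓛` away from `v₀`, hence
  -- `w⁻¹𝓕^* = 𝓖` and `w⁻¹𝓖^* = 𝓕`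
  have hTF : inv.dualTransported 𝓕 θ = 𝓖 := by
    rw [h𝓕, dualTransported_update_bot]
    funext v
    by_cases hv : v = v₀
    · subst hv; rw [Function.update_self, h𝓖, Function.update_self]
    · rw [Function.update_of_ne hv, h𝓖, Function.update_of_ne hv, hsd v hv]
  have hTG : inv.dualTransported 𝓖 θ = 𝓕 := by
    rw [h𝓖, hv₀def, dualTransported_update_top W n e hμ hadd₁ hadd₂ hgal hnondeg inv hperf]
    funext v
    by_cases hv : v = v₀
    · subst hv; rw [hv₀def, Function.update_self, h𝓕, Function.update_self]
    · rw [← hv₀def, Function.update_of_ne hv, h𝓕, Function.update_of_ne hv, hsd v hv]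
  -- the dual Selmer groups are the Weil transports of the Selmer groups of `𝓖`, `𝓕`
  have hdF : (inv.dualSelmerStructure (W.torsionGaloisModule n) 𝓕).selmerGroup =
      𝓖.selmerGroup.map (galoisCohomology.map θ 1) := by
    rw [dualSelmerGroup_eq_map_selmerGroup_dualTransported W n e hμ hadd₁ hadd₂ hgal hnondeg inv 𝓕, hTF]
  have hdG : (inv.dualSelmerStructure (W.torsionGaloisModule n) 𝓖).selmerGroup =
      𝓕.selmerGroup.map (galoisCohomology.map θ 1) := by
    rw [dualSelmerGroup_eq_map_selmerGroup_dualTransported W n e hμ hadd₁ hadd₂ hgal hnondeg inv 𝓖, hTG]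
  -- multr1-p1's counting form at the one place `v₀`
  have hcount := X11b.PoitouTateCounting.relIndex_selmerGroup_mul_relIndex_dual_eq
    (ρ := W.torsionGaloisModule n) (𝓕 := 𝓕) (𝓖 := 𝓖) (w₀ := w₀) hperf hvan hcomp hM hS
    (update_bot_le_update_top W n 𝓛 v₀)
    (isUnramifiedOutside_update W n h𝓛 hw₀ ⊥) (isUnramifiedOutside_update W n h𝓛 hw₀ ⊤) hw₀
    (fun v hv => update_bot_eq_update_top_of_ne W n 𝓛 v₀ v hv)
  rw [hdF, hdG, AddSubgroup.relIndex_map_map_of_injective _ _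
    (map_weilDual_injective W n e hμ hadd₁ hadd₂ hgal hnondeg)] at hcount
  -- `[⊤ : ⊥] = #H¹(K_{v₀}, E[n])`
  have hbt : (𝓕 v₀).relIndex (𝓖 v₀) =
      Nat.card (galoisCohomology ((W.torsionGaloisModule n).toLocal v₀) 1) := by
    rw [h𝓕, h𝓖, Function.update_self, Function.update_self, AddSubgroup.relIndex_bot_left,
      AddSubgroup.card_top]
  rw [sq, ← hbt]
  exact hcount

/-! ## §4. With Tate's local Euler characteristic at `v₀`: the index is `#E(K_{v₀})[n] · #(𝓞_{v₀}/n)` -/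

include hnondeg in
/-- **`[H¹_{𝓛^{v₀}} : H¹_{𝓛_{v₀}}] = #E(K_{v₀})[n] · #(𝓞_{v₀}/n)`** for a residually self-dual `𝓛` and a
prime power `n`: the square root of §3's `#H¹(K_{v₀}, E[n])`, which Tate's local Euler–Poincaré
characteristic (the tree's named fact `localEulerPoincareCharacteristic K_{v₀}`, Milne I Thm. 2.8, a
HYPOTHESIS here) evaluates as `(#E(K_{v₀})[n] · #(𝓞_{v₀}/n))²`
(`natCard_galoisCohomology_one_torsion_adicCompletion_eq_sq`).  The right-hand side is the order of
the local Kummer condition `#𝓛_{v₀}^{Kummer} = #E(K_{v₀})/n` (Milne I Lemma 3.3).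
[cite: MilneADT2006, Ch. I, Thm. 2.8 and Lemma 3.3] [cite: Howard2004HeegnerKolyvagin, Thm. 2.1.11 (arXiv:1202.6340 p. 6)] -/
theorem relIndex_update_bot_update_top_eq_of_localEuler (hperf : inv.IsPerfect)
    (hvan : inv.SumLocalTermEqZero) (hcomp : inv.SelmerComplement) {S : Finset (Place K)}
    (hS : ∀ v : HeightOneSpectrum (𝓞 K), (Sum.inr v : Place K) ∉ S →
      ((n : ℕ) : 𝓞 K) ∉ v.asIdeal ∧ GaloisRep.IsUnramifiedAt v (W.torsionGaloisModule n))
    {𝓛 : SelmerStructure (W.torsionGaloisModule n)} (h𝓛 : 𝓛.IsUnramifiedOutside S)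
    {w₀ : HeightOneSpectrum (𝓞 K)} (hw₀ : (Sum.inr w₀ : Place K) ∈ S)
    (hsd : ∀ v ≠ (Sum.inr w₀ : Place K),
      inv.dualTransported 𝓛 (weilDualIntertwining W n e hμ hadd₁ hadd₂ hgal) v = 𝓛 v)
    (hn : IsPrimePow n) (hEP : localEulerPoincareCharacteristic (w₀.adicCompletion K)) :
    (SelmerStructure.selmerGroup
          (Function.update 𝓛 (Sum.inr w₀) ⊥ : SelmerStructure (W.torsionGaloisModule n))).relIndex
        (SelmerStructure.selmerGroup
          (Function.update 𝓛 (Sum.inr w₀) ⊤ : SelmerStructure (W.torsionGaloisModule n))) =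
      Nat.card (nsmulAddMonoidHom n : (W.baseChange (w₀.adicCompletion K)).toAffine.Point →+ _).ker *
        Nat.card (w₀.adicCompletionIntegers K ⧸ Ideal.span {(n : w₀.adicCompletionIntegers K)}) := by
  have h := relIndex_update_bot_update_top_sq_eq_natCard W n e hμ hadd₁ hadd₂ hgal hnondeg inv hperf hvan
    hcomp hS h𝓛 hw₀ hsd
  have hH : Nat.card (galoisCohomology ((W.torsionGaloisModule n).toLocal (Sum.inr w₀)) 1) =
      (Nat.card (nsmulAddMonoidHom n : (W.baseChange (w₀.adicCompletion K)).toAffine.Point →+ _).ker *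
        Nat.card (w₀.adicCompletionIntegers K ⧸
          Ideal.span {(n : w₀.adicCompletionIntegers K)})) ^ 2 :=
    natCard_galoisCohomology_one_torsion_adicCompletion_eq_sq W w₀ n hn hEP
  rw [hH, sq, sq] at h
  exact Nat.mul_self_inj.mp h

end General

end Summit.BirchSwinnertonDyer.Rank1Residual.X5.SelfDualCount

end
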